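import Summits.NavierStokesRegularity.NavierStokesRegularity.Theses.AxisymmetricExtremality
import Summits.NavierStokesRegularity.NavierStokesRegularity.Theorems.AxisymmetricExtremalityAxisymmetricKatoGlobalStubSeregin2020TypeIISwirlVanishesRepr
import Literature.Analysis.FluidPDE.Seregin2020SwirlMoserCutoffs
import HarnessLib

/-!
# Seregin 2020, Lemma 2.2 (after Nazarov–Uraltseva 2012): the axis cut-off `ψ_ε` as a factor
# of space–time test functions, and its removal `ε → 0`

Helper toward the stub `stub_seregin2020TypeII` of the crux `AxisymmetricKatoGlobal` (= the named
fact `Literature.Analysis.FluidPDE.Seregin2020_axisymmetricSingularPoint_typeII`, G. Seregin,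
Anal. Math. Phys. 10 (2020) Paper 46 = arXiv:2006.04140, Thm 2.1; remaining ingredient Lemma 2.2
in the corrected rendering `hWH′`). The very weak form of (2.12) with the axis term (Seregin's
displayed inequality, arXiv p. 8; Nazarov–Uraltseva's (4.5)) is derived by testing the pointwise
inequality, valid off the axis, with `η ψ_ε`, where `η ≥ 0` is the given space–time test function
and `ψ_ε(x) = sT((2/ε)|x'| - 1)` is the axis cut-off of the tree (`Seregin2020.axisCutoff_props`:
smooth, `0 ≤ ψ_ε ≤ 1`, `ψ_ε = 0` for `ϱ ≤ ε/2`, `ψ_ε = 1` for `ϱ ≥ ε`, `|∇ψ_ε| ≤ 2C_T/ε`), and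
letting `ε → 0`. This file supplies the bookkeeping of that device:

* `isSpaceTimeTestOn_mul_axisCutoff` — `η ψ_ε` is a space–time test function on every open set
  containing `W ∩ {ϱ ≠ 0}` when `η` is one on `W`;
* `timeDeriv_mul_axisCutoff`, `fderiv_mul_axisCutoff_apply` — `∂ₜ(ηψ_ε) = ψ_ε ∂ₜη`,
  `D(ηψ_ε)[v] = ψ_ε Dη[v] + η Dψ_ε[v]`;
* `abs_fderiv_axisCutoff_apply_le`, `fderiv_axisCutoff_eq_zero_of_lt` — the `ε`-uniform bound
  `|Dψ_ε(x)[v]| ≤ (2C_T/ϱ(x)) ‖v‖` and `Dψ_ε(x) = 0` for `ϱ(x) > ε`;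
* `axisCutoff_eventuallyEq_one` — off the axis `ψ_ε(x) = 1` for all small `ε`;
* `tendsto_integral_mul_axisCutoff` — **removal of the cut-off**: `∫∫ f ψ_ε → ∫∫ f` as `ε → 0⁺`
  for every integrable `f` on `ℝ × ℝ³` (dominated convergence; the axis is null).

## References

* G. Seregin, Anal. Math. Phys. 10 (2020), Paper 46 = arXiv:2006.04140, proof of Thm 2.1
  (arXiv p. 5, the cut-off `φ` of the axis) and of Lemma 2.2 (arXiv p. 8). [Seregin2020]
* A. I. Nazarov, N. N. Uraltseva, St. Petersburg Math. J. 23 (2012) 93–115 = arXiv:1011.1888,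
  §4, (4.5). [NazarovUraltseva2012]
-/

-- the problem directory repeats the summit name (D-0017); core's `dupNamespace` linter fires
set_option linter.dupNamespace false

noncomputable section

open MeasureTheory Set Function Filter Topology TopologicalSpace Metric WithLp
open scoped NNReal ENNReal InnerProductSpace RealInnerProductSpace

namespace Summit.NavierStokesRegularity.NavierStokesRegularity.Theorems.AxisymmetricKatoGlobal.EulerScaling

open Literature.Analysis.FluidPDE Literature.Analysis.FluidPDE.Seregin2020

/-! ### `η ψ_ε` is a test function supported off the axis -/

/-- **The product `η ψ_ε` of a space–time test function on `W` with the axis cut-off is a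
space–time test function on every open `V ⊇ W ∩ {ϱ ≠ 0}`** (smooth with compact support inside
`tsupport η ∩ {ϱ ≥ ε/2}`). [folklore] -/
theorem isSpaceTimeTestOn_mul_axisCutoff {W V : Opens (ℝ × EuclideanSpace ℝ (Fin 3))}
    {η : ℝ → EuclideanSpace ℝ (Fin 3) → ℝ} (hη : IsSpaceTimeTestOn W η) {ε : ℝ} (hε : 0 < ε)
    {φ : EuclideanSpace ℝ (Fin 3) → ℝ} (hφ : ∀ x, φ x = Real.smoothTransition (2 / ε * cylRadius x - 1))
    (hV : (W : Set (ℝ × EuclideanSpace ℝ (Fin 3))) ∩ {z | cylRadius z.2 ≠ 0} ⊆ (V : Set (ℝ × EuclideanSpace ℝ (Fin 3)))) :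
    IsSpaceTimeTestOn V (fun t x => η t x * φ x) := by
  obtain ⟨CT, -, hCT⟩ := LeiZhang2011.exists_abs_deriv_smoothTransition_le
  obtain ⟨hsmooth, -, hzero, -⟩ := axisCutoff_props hε hCT hφ
  have hprod : uncurry (fun t x => η t x * φ x) = fun z : ℝ × EuclideanSpace ℝ (Fin 3) => uncurry η z * φ z.2 := by
    funext z; rfl
  refine ⟨?_, ?_, ?_⟩
  · rw [hprod]
    exact hη.contDiff.mul (hsmooth.comp contDiff_snd)
  · rw [hprod]
    exact hη.hasCompactSupport.mul_right
  · rw [hprod]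
    intro z hz
    refine hV ⟨hη.tsupport_subset (tsupport_mul_subset_left hz), ?_⟩
    -- `tsupport (φ ∘ snd) ⊆ {ε/2 ≤ ϱ}`
    have h2 : z ∈ tsupport (fun z : ℝ × EuclideanSpace ℝ (Fin 3) => φ z.2) := tsupport_mul_subset_right hz
    have hsub : tsupport (fun z : ℝ × EuclideanSpace ℝ (Fin 3) => φ z.2) ⊆ {z | ε / 2 ≤ cylRadius z.2} := by
      refine closure_minimal (fun w hw => ?_) (isClosed_le continuous_const (continuous_cylRadius.comp continuous_snd))
      by_contra h
      exact hw (hzero w.2 (le_of_lt (not_le.1 h)))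
    have : ε / 2 ≤ cylRadius z.2 := hsub h2
    show cylRadius z.2 ≠ 0
    intro h0; rw [h0] at this; linarith

/-- `∂ₜ(η ψ_ε) = ψ_ε ∂ₜη` (the cut-off does not depend on time). [folklore] -/
theorem timeDeriv_mul_axisCutoff (η : ℝ → EuclideanSpace ℝ (Fin 3) → ℝ) (φ : EuclideanSpace ℝ (Fin 3) → ℝ) (t : ℝ)
    (x : EuclideanSpace ℝ (Fin 3)) : timeDeriv (fun t x => η t x * φ x) t x = φ x * timeDeriv η t x := by
  simp only [timeDeriv_apply]
  rw [deriv_mul_const_field, mul_comm]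

/-- `D(η(t,·) ψ_ε)(x)[v] = ψ_ε(x) Dη(t,·)(x)[v] + η(t,x) Dψ_ε(x)[v]`. [folklore] -/
theorem fderiv_mul_axisCutoff_apply {W : Opens (ℝ × EuclideanSpace ℝ (Fin 3))}
    {η : ℝ → EuclideanSpace ℝ (Fin 3) → ℝ} (hη : IsSpaceTimeTestOn W η) {ε : ℝ} (hε : 0 < ε)
    {φ : EuclideanSpace ℝ (Fin 3) → ℝ} (hφ : ∀ x, φ x = Real.smoothTransition (2 / ε * cylRadius x - 1))
    (t : ℝ) (x v : EuclideanSpace ℝ (Fin 3)) :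
    fderiv ℝ (fun x => η t x * φ x) x v = φ x * fderiv ℝ (η t) x v + η t x * fderiv ℝ φ x v := by
  obtain ⟨CT, -, hCT⟩ := LeiZhang2011.exists_abs_deriv_smoothTransition_le
  obtain ⟨hsmooth, -⟩ := axisCutoff_props hε hCT hφ
  have hηd : DifferentiableAt ℝ (η t) x := ((hη.contDiff_slice t).differentiable (by simp)) x
  have hφd : DifferentiableAt ℝ φ x := (hsmooth.differentiable (by simp)) x
  rw [fderiv_fun_mul hηd hφd]
  simp only [_root_.add_apply, FunLike.coe_smul, Pi.smul_apply, smul_eq_mul]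
  ring

/-! ### Bounds and limits of the cut-off -/

/-- **`ε`-uniform bound of the gradient of the axis cut-off**: `|Dψ_ε(x)[v]| ≤ (2C_T/ϱ(x)) ‖v‖`
(`Dψ_ε` lives on `{ε/2 ≤ ϱ ≤ ε}`, where `|∇ψ_ε| ≤ 2C_T/ε ≤ 2C_T/ϱ`). [folklore] -/
theorem abs_fderiv_axisCutoff_apply_le {ε : ℝ} (hε : 0 < ε) {CT : ℝ} (hCT : ∀ t, |deriv Real.smoothTransition t| ≤ CT)
    {φ : EuclideanSpace ℝ (Fin 3) → ℝ} (hφ : ∀ x, φ x = Real.smoothTransition (2 / ε * cylRadius x - 1))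
    (x v : EuclideanSpace ℝ (Fin 3)) : |fderiv ℝ φ x v| ≤ 2 * CT / cylRadius x * ‖v‖ := by
  obtain ⟨-, -, -, -, -, -, hgrad, hoff⟩ := axisCutoff_props hε hCT hφ
  have hCT0 : 0 ≤ CT := (abs_nonneg _).trans (hCT 0)
  by_cases hx : ε < cylRadius x
  · rw [hoff x (Or.inr hx)]
    simp only [_root_.zero_apply, abs_zero]
    exact mul_nonneg (div_nonneg (by positivity) (cylRadius_nonneg x)) (norm_nonneg v)
  · by_cases hx' : cylRadius x < ε / 2
    · rw [hoff x (Or.inl hx')]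
      simp only [_root_.zero_apply, abs_zero]
      exact mul_nonneg (div_nonneg (by positivity) (cylRadius_nonneg x)) (norm_nonneg v)
    · have hρ0 : 0 < cylRadius x := lt_of_lt_of_le (by positivity) (not_lt.1 hx')
      have hρε : cylRadius x ≤ ε := not_lt.1 hx
      calc |fderiv ℝ φ x v| = |⟪gradient φ x, v⟫| := by rw [inner_gradient_left]
        _ ≤ ‖gradient φ x‖ * ‖v‖ := abs_real_inner_le_norm _ _
        _ ≤ 2 * CT / ε * ‖v‖ := mul_le_mul_of_nonneg_right (hgrad x) (norm_nonneg v)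
        _ ≤ 2 * CT / cylRadius x * ‖v‖ := by
            refine mul_le_mul_of_nonneg_right ?_ (norm_nonneg v)
            exact div_le_div_of_nonneg_left (by positivity) hρ0 hρε

/-- `Dψ_ε(x) = 0` for `ϱ(x) > ε` (there `ψ_ε ≡ 1` near `x`). [folklore] -/
theorem fderiv_axisCutoff_eq_zero_of_lt {ε : ℝ} (hε : 0 < ε)
    {φ : EuclideanSpace ℝ (Fin 3) → ℝ} (hφ : ∀ x, φ x = Real.smoothTransition (2 / ε * cylRadius x - 1))
    {x : EuclideanSpace ℝ (Fin 3)} (hx : ε < cylRadius x) : fderiv ℝ φ x = 0 := by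
  obtain ⟨CT, -, hCT⟩ := LeiZhang2011.exists_abs_deriv_smoothTransition_le
  obtain ⟨-, -, -, -, -, -, -, hoff⟩ := axisCutoff_props hε hCT hφ
  exact hoff x (Or.inr hx)

/-- **Off the axis the cut-off is eventually `1`**: if `ϱ(x) ≠ 0` then `ψ_ε(x) = 1` for all
`0 < ε ≤ ϱ(x)`. [folklore] -/
theorem axisCutoff_eventuallyEq_one {x : EuclideanSpace ℝ (Fin 3)} (hx : cylRadius x ≠ 0) :
    ∀ᶠ ε in 𝓝[>] (0 : ℝ), Real.smoothTransition (2 / ε * cylRadius x - 1) = 1 := by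
  have hρ : 0 < cylRadius x := lt_of_le_of_ne (cylRadius_nonneg x) (Ne.symm hx)
  have hmem : Ioo (0 : ℝ) (cylRadius x) ∈ 𝓝[>] (0 : ℝ) := Ioo_mem_nhdsGT hρ
  filter_upwards [hmem] with ε hε
  refine Real.smoothTransition.one_of_one_le ?_
  rw [le_sub_iff_add_le, div_mul_eq_mul_div, le_div_iff₀ hε.1]
  linarith [hε.2]

/-- Off the axis, `Dψ_ε(x) = 0` for all small `ε > 0`. [folklore] -/
theorem fderiv_axisCutoff_eventuallyEq_zero {φ : ℝ → EuclideanSpace ℝ (Fin 3) → ℝ}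
    (hφ : ∀ ε x, φ ε x = Real.smoothTransition (2 / ε * cylRadius x - 1))
    {x : EuclideanSpace ℝ (Fin 3)} (hx : cylRadius x ≠ 0) :
    ∀ᶠ ε in 𝓝[>] (0 : ℝ), fderiv ℝ (φ ε) x = 0 := by
  have hρ : 0 < cylRadius x := lt_of_le_of_ne (cylRadius_nonneg x) (Ne.symm hx)
  filter_upwards [Ioo_mem_nhdsGT hρ] with ε hε
  exact fderiv_axisCutoff_eq_zero_of_lt hε.1 (hφ ε) hε.2

/-- **Removal of the axis cut-off under the integral sign.** For `f` integrable on `ℝ × ℝ³`,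
`∫∫ f(t,x) ψ_ε(x) dx dt → ∫∫ f` as `ε → 0⁺` (`|ψ_ε| ≤ 1`, `ψ_ε → 1` off the axis, which is
Lebesgue-null; dominated convergence). This is the passage `ε → 0` in the bulk terms
`∫∫ Φ ψ_ε ∂ₜη`, `∫∫ Φ ψ_ε (U + 2x'/|x'|²)·∇η`, `∫∫ ΔΦ η ψ_ε` of the derivation of the very weak
form. [folklore] -/
theorem tendsto_integral_mul_axisCutoff : ∀ {f : ℝ × EuclideanSpace ℝ (Fin 3) → ℝ}, Integrable f →
    Tendsto (fun ε : ℝ => ∫ z : ℝ × EuclideanSpace ℝ (Fin 3), f z * Real.smoothTransition (2 / ε * cylRadius z.2 - 1))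
      (𝓝[>] 0) (𝓝 (∫ z, f z)) := by
  intro f hf
  have hlim : ∫ z, f z = ∫ z : ℝ × EuclideanSpace ℝ (Fin 3), f z * 1 := by simp
  rw [hlim]
  refine tendsto_integral_filter_of_dominated_convergence (fun z => ‖f z‖) ?_ ?_ hf.norm ?_
  · refine Eventually.of_forall fun ε => hf.aestronglyMeasurable.mul ?_
    exact (Real.smoothTransition.continuous.comp (((continuous_const.mul
      (continuous_cylRadius.comp continuous_snd)).sub continuous_const))).aestronglyMeasurable
  · refine Eventually.of_forall fun ε => Eventually.of_forall fun z => ?_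
    rw [norm_mul, Real.norm_eq_abs (Real.smoothTransition _), abs_of_nonneg (Real.smoothTransition.nonneg _)]
    exact mul_le_of_le_one_right (norm_nonneg _) (Real.smoothTransition.le_one _)
  · have hae : ∀ᵐ z : ℝ × EuclideanSpace ℝ (Fin 3), cylRadius z.2 ≠ 0 := by
      have h := volume_setOf_cylRadius_snd_eq_zero
      rw [ae_iff]
      simpa using h
    filter_upwards [hae] with z hz
    refine (tendsto_const_nhds (x := f z * 1)).congr' ?_
    filter_upwards [axisCutoff_eventuallyEq_one hz] with ε hε
    rw [hε]

end Summit.NavierStokesRegularity.NavierStokesRegularity.Theorems.AxisymmetricKatoGlobal.EulerScaling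

end
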